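import Literature.Geometry.Kaehler.ComplexTorusDivisorClassesLefschetzOperators
import Literature.Geometry.Kaehler.ComplexTorusHardLefschetz
import HarnessLib

/-!
# The exotic rank `e_p(X) = dim_ℚ Bᵖ(X) − dim_ℚ Dᵖ(X)` of a polarised complex torus is symmetric about the middle
# codimension: `e_p(X) = e_{g−p}(X)` (hard Lefschetz on Hodge classes AND on Lefschetz classes)

Layer `Literature/Geometry/Kaehler`, namespace `Literature.Geometry.Kaehler.ComplexTorus`; lane `lit-hodgefound` (Track 2
foundations library, Layer A4), skeleton seat `lit-hodgefound-skel-4` (generation 39), rider to rows A4-24 / A4-96 of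
`run/shared/lean/pub/lit-hodgefound/SKELETON.md` (§A4-DETAIL).  THEOREMS ONLY (no definition, no instance, no named fact;
D-0026 net debt `0`).  Everything is a composition BY NAME of the tree's two hard-Lefschetz dimension counts —
`finrank_hodgeClasses_eq_of_add_eq` (`dim_ℚ Bᵖ = dim_ℚ B^{g−p}`, `ComplexTorusHardLefschetz`, Lange §7.3.2 (1)) and
`finrank_divisorClasses_eq_of_two_mul_add_eq` (`dim_ℚ Dᵖ = dim_ℚ D^{g−p}`, `ComplexTorusDivisorClassesLefschetzOperators`,
Milne's `A(X, L)`) — and of the equality transfer `divisorClasses_eq_hodgeClasses_iff_of_two_mul_add_eq`, restated for an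
arbitrary splitting `p + q = g` (either order) and for `IsRiemannForm` / `IsAbelianVariety` hypotheses.

## Sources, verbatim

* H. Lange, *Abelian Varieties over the Complex Numbers* (2023) [Lange2023AbelianVarietiesComplex], §7.3.2 (1) (hard
  Lefschetz: `L^{g−2p} : H^{2p}(X, ℚ) ⥲ H^{2g−2p}(X, ℚ)` respects Hodge classes) and §7.3.3 Exercise (2)(b) («`Dᵖ(X) = H^{2p}_Hodge(X)`
  implies `D^{g−p}(X) = H^{2g−2p}_Hodge(X)`»).
* J. S. Milne, *Lefschetz classes on abelian varieties*, Duke Math. J. 96 (1999) [Milne1999LefschetzClasses], §5 p. 665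
  (the statement `A(X, L)`: `L^{g−2p}` is a bijection on Lefschetz classes) and Remark 5.11.
* B. van Geemen, LNM 1594 (1994) [vanGeemen1994HodgeAV], 2.4–2.5 («`Dᵖ ⊂ Bᵖ` … An exceptional Hodge class (of codimension
  `p`) is an element of `Bᵖ` which is not in `Dᵖ`») and B. B. Gordon [Gordon1999HodgeAVSurvey], 9.2.2 (the count
  `dim Hdg^p(A) − dim Div^p(A)` of independent exceptional classes).

## What is proved (`X = E/Φ(ℤ^ι)` with a Riemann form `η`, `g = dim_ℂ E`, `p + q = g`)

* `IsRiemannForm.finrank_divisorClasses_eq_of_add_eq` — `dim_ℚ Dᵖ(X) = dim_ℚ D^q(X)` (the `IsRiemannForm` / any-order form of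
  the tree's `finrank_divisorClasses_eq_of_two_mul_add_eq`);
* **`IsRiemannForm.finrank_hodgeClasses_sub_finrank_divisorClasses_eq_of_add_eq` — `e_p(X) = e_q(X)`**: the number of
  `ℚ`-independent exceptional Hodge classes is the same in complementary codimensions; `IsAbelianVariety.…` form;
* `IsRiemannForm.divisorClasses_eq_hodgeClasses_iff_of_add_eq` — `Dᵖ = Bᵖ ⟺ D^q = B^q` (either order), and its negation
  `IsRiemannForm.divisorClasses_ne_hodgeClasses_iff_of_add_eq` (an exceptional class in codimension `p` iff one in
  codimension `g − p`); `IsAbelianVariety.…` forms.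

## References

* [Lange2023AbelianVarietiesComplex] H. Lange, *Abelian Varieties over the Complex Numbers*, Grundlehren Text Editions (2023),
  §7.3.2 (1), §7.3.3 Exercise (2)(b).
* [Milne1999LefschetzClasses] J. S. Milne, *Lefschetz classes on abelian varieties*, Duke Math. J. 96 (1999) 639–675, §5
  p. 665, Rem. 5.11.
* [vanGeemen1994HodgeAV] B. van Geemen, *An introduction to the Hodge conjecture for abelian varieties*, LNM 1594 (1994), 2.4–2.5.
* [Gordon1999HodgeAVSurvey] B. B. Gordon, *A survey of the Hodge conjecture for abelian varieties*, CRM Monogr. Ser. 10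
  (1999), App. B, 9.2.2.
-/

noncomputable section

open Module Function

namespace Literature.Geometry.Kaehler

namespace ComplexTorus

variable {ι : Type*} [Fintype ι] {E : Type*} [NormedAddCommGroup E] [NormedSpace ℂ E] (Φ : (ι → ℝ) ≃L[ℝ] E)
  {η : E [⋀^Fin 2]→L[ℝ] ℝ}

/-- Finite-dimensionality of `E` over `ℂ` from the period isomorphism. [folklore] -/
private theorem ers_finiteDimensional_complex (Φ : (ι → ℝ) ≃L[ℝ] E) : FiniteDimensional ℂ E :=
  haveI : FiniteDimensional ℝ E := LinearEquiv.finiteDimensional Φ.toLinearEquiv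
  Module.Finite.of_restrictScalars_finite ℝ ℂ E

/-- **`dim_ℚ Dᵖ(X) = dim_ℚ D^q(X)` for `p + q = g`** on a polarised complex torus: Milne's `A(X, L)` — `L^{g−2p}` is a
bijection on Lefschetz classes — in either order of `p, q`. [cite: Milne1999LefschetzClasses, §5 p. 665 (after Thm. 5.9)]
[cite: Lange2023AbelianVarietiesComplex, §7.3.3 Exercise (2)(b)] -/
theorem IsRiemannForm.finrank_divisorClasses_eq_of_add_eq (hη : IsRiemannForm Φ η) {p q : ℕ} (hpq : p + q = finrank ℂ E) :
    finrank ℚ (divisorClasses Φ p) = finrank ℚ (divisorClasses Φ q) := by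
  haveI := ers_finiteDimensional_complex Φ
  wlog hle : p ≤ q generalizing p q
  · exact (this (by omega) (by omega)).symm
  obtain ⟨t, rfl⟩ := Nat.exists_eq_add_of_le hle
  exact finrank_divisorClasses_eq_of_two_mul_add_eq Φ hη.isNSForm (IsRiemannForm.exists_apply_ne_zero Φ hη) (by omega)

/-- **The exotic rank is symmetric about the middle codimension: `e_p(X) = e_q(X)` for `p + q = g`**, where
`e_p(X) = dim_ℚ Bᵖ(X) − dim_ℚ Dᵖ(X)` is the number of `ℚ`-independent exceptional Hodge classes of codimension `p` —
hard Lefschetz identifies `Bᵖ` with `B^q` (Lange §7.3.2 (1)) and `Dᵖ` with `D^q` (Milne's `A(X, L)`).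
[cite: Lange2023AbelianVarietiesComplex, §7.3.2 (1) and §7.3.3 Exercise (2)(b)] [cite: Milne1999LefschetzClasses, §5 p. 665]
[cite: vanGeemen1994HodgeAV, 2.5] [cite: Gordon1999HodgeAVSurvey, 9.2.2] -/
theorem IsRiemannForm.finrank_hodgeClasses_sub_finrank_divisorClasses_eq_of_add_eq (hη : IsRiemannForm Φ η) {p q : ℕ}
    (hpq : p + q = finrank ℂ E) :
    finrank ℚ (hodgeClasses Φ p) - finrank ℚ (divisorClasses Φ p) =
      finrank ℚ (hodgeClasses Φ q) - finrank ℚ (divisorClasses Φ q) := by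
  haveI := ers_finiteDimensional_complex Φ
  rw [hη.finrank_hodgeClasses_eq_of_add_eq Φ hpq, hη.finrank_divisorClasses_eq_of_add_eq Φ hpq]

/-- `IsAbelianVariety` form: **`e_p(X) = e_{g−p}(X)`** for every complex abelian variety.
[cite: Lange2023AbelianVarietiesComplex, §7.3.2 (1) and §7.3.3 Exercise (2)(b)] [cite: Milne1999LefschetzClasses, §5 p. 665] -/
theorem IsAbelianVariety.finrank_hodgeClasses_sub_finrank_divisorClasses_eq_of_add_eq (hX : IsAbelianVariety Φ) {p q : ℕ}
    (hpq : p + q = finrank ℂ E) :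
    finrank ℚ (hodgeClasses Φ p) - finrank ℚ (divisorClasses Φ p) =
      finrank ℚ (hodgeClasses Φ q) - finrank ℚ (divisorClasses Φ q) := by
  obtain ⟨η, hη⟩ := hX
  exact hη.finrank_hodgeClasses_sub_finrank_divisorClasses_eq_of_add_eq Φ hpq

/-- **`Dᵖ(X) = Bᵖ(X) ⟺ D^q(X) = B^q(X)` for `p + q = g`** (either order; the `IsRiemannForm` form of the tree's
`divisorClasses_eq_hodgeClasses_iff_of_two_mul_add_eq`). [cite: Lange2023AbelianVarietiesComplex, §7.3.3 Exercise (2)(b)]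
[cite: Milne1999LefschetzClasses, §5 Rem. 5.11] -/
theorem IsRiemannForm.divisorClasses_eq_hodgeClasses_iff_of_add_eq (hη : IsRiemannForm Φ η) {p q : ℕ}
    (hpq : p + q = finrank ℂ E) :
    divisorClasses Φ p = hodgeClasses Φ p ↔ divisorClasses Φ q = hodgeClasses Φ q := by
  haveI := ers_finiteDimensional_complex Φ
  wlog hle : p ≤ q generalizing p q
  · exact (this (by omega) (by omega)).symm
  obtain ⟨t, rfl⟩ := Nat.exists_eq_add_of_le hle
  rw [add_comm p t]
  exact divisorClasses_eq_hodgeClasses_iff_of_two_mul_add_eq Φ hη.isNSForm (IsRiemannForm.exists_apply_ne_zero Φ hη)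
    (by omega)

/-- **An exceptional Hodge class in codimension `p` iff one in codimension `g − p`.**
[cite: Lange2023AbelianVarietiesComplex, §7.3.3 Exercise (2)(b)] [cite: vanGeemen1994HodgeAV, 2.5] -/
theorem IsRiemannForm.divisorClasses_ne_hodgeClasses_iff_of_add_eq (hη : IsRiemannForm Φ η) {p q : ℕ}
    (hpq : p + q = finrank ℂ E) :
    divisorClasses Φ p ≠ hodgeClasses Φ p ↔ divisorClasses Φ q ≠ hodgeClasses Φ q :=
  not_congr (hη.divisorClasses_eq_hodgeClasses_iff_of_add_eq Φ hpq)

/-- `IsAbelianVariety` form: `Dᵖ = Bᵖ ⟺ D^{g−p} = B^{g−p}`. [cite: Lange2023AbelianVarietiesComplex, §7.3.3 Exercise (2)(b)] -/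
theorem IsAbelianVariety.divisorClasses_eq_hodgeClasses_iff_of_add_eq (hX : IsAbelianVariety Φ) {p q : ℕ}
    (hpq : p + q = finrank ℂ E) :
    divisorClasses Φ p = hodgeClasses Φ p ↔ divisorClasses Φ q = hodgeClasses Φ q := by
  obtain ⟨η, hη⟩ := hX
  exact hη.divisorClasses_eq_hodgeClasses_iff_of_add_eq Φ hpq

/-- `IsAbelianVariety` form: an exceptional class in codimension `p` iff in codimension `g − p`.
[cite: Lange2023AbelianVarietiesComplex, §7.3.3 Exercise (2)(b)] [cite: vanGeemen1994HodgeAV, 2.5] -/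
theorem IsAbelianVariety.divisorClasses_ne_hodgeClasses_iff_of_add_eq (hX : IsAbelianVariety Φ) {p q : ℕ}
    (hpq : p + q = finrank ℂ E) :
    divisorClasses Φ p ≠ hodgeClasses Φ p ↔ divisorClasses Φ q ≠ hodgeClasses Φ q :=
  not_congr (hX.divisorClasses_eq_hodgeClasses_iff_of_add_eq Φ hpq)

end ComplexTorus

end Literature.Geometry.Kaehler
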